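import Summits.QuantumAdvantage.QuantumAdvantage.Theorems.CharDialSpreadRankA

/-! # CharDialSpreadRankB — part 2/3 (mechanical split for landing of `CharDialSpreadRank`; content verbatim; scopes re-opened with their variables) -/

noncomputable section
open Finset

namespace Summit.QuantumAdvantage.AdviceFreeQNC0.WindowCounter
open Summit.QuantumAdvantage.AdviceFreeQNC0

section FormJuntaGen
variable (p : ℕ) [Fact p.Prime] {n : ℕ}

/-- **the junta bias for `(log₂ n)^C`-juntas**, every `C`, every prime `p ≥ 5`, dense directions. -/
theorem formJunta_small_pow (hp : 5 ≤ p) (C : ℕ) : ∀ ε : ℝ, 0 < ε → ∃ n₁ : ℕ, ∀ n ≥ n₁, ∀ (c : ℕ) (a : Fin n → ZMod p)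
    (y : Fin (n + 1) → (Fin n → Bool) → Bool),
      (∀ g, ∃ J : Finset (Fin n), J.card ≤ Nat.log 2 n ^ C ∧ ∀ u v : Fin n → Bool, (∀ i ∈ J, u i = v i) → y g u = y g v) →
      n ≤ 2 * (univ.filter fun i : Fin n => a i ≠ 0).card →
        ∀ t : ZMod p, t ≠ 0 → ‖formSum p a c y t‖ ≤ ε * 2 ^ n := by
  intro ε hε
  obtain ⟨Q, hQ⟩ := formJunta_small_gen p hp ε hε
  obtain ⟨N₀, hN₀⟩ := DWalk.const_mul_logPow_le' Q (2 * C)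
  refine ⟨max N₀ 16, fun n hn c a y hy hdense t ht => ?_⟩
  have hn16 : 16 ≤ n := le_trans (le_max_right _ _) hn
  have hℓ1 : 1 ≤ Nat.log 2 n ^ C := Nat.one_le_pow _ _ (Nat.log_pos one_lt_two (by omega))
  have hlog : Q * (Nat.log 2 n ^ C) ^ 2 ≤ n := by
    rw [← pow_mul, mul_comm C 2]; exact hN₀ n (le_trans (le_max_left _ _) hn)
  exact hQ n (Nat.log 2 n ^ C) hℓ1 hlog hn16 c a y hy hdense t ht

/-- **well-spread `(log₂ n)^C`-junta ⊕ `r`-form strategies lose**, ONE rate for all `r`, `C` (the junta rung `walkHardFJuntaCuts`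
gives one `θ₀` for every exponent `C`; `form_reductionR` fed with `formJunta_small_pow`). -/
theorem formJuntaR_hard_pow (hp : 5 ≤ p) {θ₀ : ℝ} (hθ₀ : θ₀ < 1) (C : ℕ)
    (h1 : ∃ n₀ : ℕ, ∀ n ≥ n₀, ∀ (c : ℕ) (y : Fin (n + 1) → (Fin n → Bool) → Bool),
      (∀ g, ∃ J : Finset (Fin n), J.card ≤ Nat.log 2 n ^ C ∧ ∀ u v : Fin n → Bool, (∀ i ∈ J, u i = v i) → y g u = y g v) →
        (#{u : Fin n → Bool | ringWinU c y u = true} : ℝ) ≤ θ₀ * 2 ^ n) (r : ℕ) :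
    ∃ n₂ : ℕ, ∀ n ≥ n₂, ∀ (c : ℕ) (A : Fin r → Fin n → ZMod p)
      (Y : (Fin r → ZMod p) → Fin (n + 1) → (Fin n → Bool) → Bool),
      (∀ t : Fin r → ZMod p, t ≠ 0 → n ≤ 2 * (univ.filter fun i : Fin n => comb p t A i ≠ 0).card) →
        (∀ s g, ∃ J : Finset (Fin n), J.card ≤ Nat.log 2 n ^ C ∧ ∀ u v : Fin n → Bool, (∀ i ∈ J, u i = v i) →
          Y s g u = Y s g v) →
        (#{u : Fin n → Bool | ringWinU c (formStratR p A Y) u = true} : ℝ) ≤ (θ₀ + (1 - θ₀) / 2) * 2 ^ n :=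
  form_reductionR p (fun {n} _ y => ∀ g, ∃ J : Finset (Fin n), J.card ≤ Nat.log 2 n ^ C ∧ ∀ u v : Fin n → Bool,
      (∀ i ∈ J, u i = v i) → y g u = y g v) h1 (formJunta_small_pow p hp C) hθ₀ r

end FormJuntaGen

/-! ## §L ONE SPARSE LINE: pencils all of whose directions OFF one line are dense

The `(r+1)`-form dial over directions `A₀, A₁, …, A_r` where `A₀` is ARBITRARY (sparse allowed) and every combination
`σA₀ + Σ_j τ_j A_{j+1}` with `τ ≠ 0` is dense.  In the character expansion over `(ℤ/p)^{r+1}` the terms with `τ = 0` (the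
line of `A₀`) are NOT small — but by one-dimensional orthogonality they sum to EXACTLY `p · #{WIN_y ∧ ⟨A₀,u⟩ = s₀}`
(`class_count_le_formLine`), and summed over the classes these fold into the win counts of the ONE-form dials
`σ ↦ Y_{(σ,τ)}` in direction `A₀` (`sum_lineClass_eq`), which lose by the rank-one theorem in ANY direction (dense:
`formJunta_small`; sparse: slicing, `form_sparse_junta_hard`).  The `τ ≠ 0` terms are dense and small.  Result:
`form_reductionLine` (rate `(1+θ₁)/2` from the rank-one rate `θ₁`), `formDialAny_hard` (one-form dials of `log₂ n`-junta
tables lose in EVERY direction), `formLine_hard`. -/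

section FormLine

open AffBells22

variable (p : ℕ) {n : ℕ}

/-- the class vector `(σ, τ)`: `σ` on the distinguished direction `A 0`, `τ` on the others. -/
def consV {r : ℕ} (σ : ZMod p) (τ : Fin r → ZMod p) : Fin (r + 1) → ZMod p := Fin.cons σ τ

/-- CharDialSpreadRankB helper `consV_zero` (decomp-qadv land package; see the module docstring). -/
@[simp] theorem consV_zero {r : ℕ} (σ : ZMod p) (τ : Fin r → ZMod p) : consV p σ τ 0 = σ := by
  simp [consV]

/-- CharDialSpreadRankB helper `consV_succ` (decomp-qadv land package; see the module docstring). -/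
@[simp] theorem consV_succ {r : ℕ} (σ : ZMod p) (τ : Fin r → ZMod p) (j : Fin r) : consV p σ τ j.succ = τ j := by
  simp [consV]

/-- CharDialSpreadRankB helper `dot_consV_zero` (decomp-qadv land package; see the module docstring). -/
theorem dot_consV_zero {r : ℕ} (σ : ZMod p) (s : Fin (r + 1) → ZMod p) :
    ∑ j, consV p σ 0 j * s j = σ * s 0 := by
  rw [Fin.sum_univ_succ]
  simp

variable [Fact p.Prime]

/-- CharDialSpreadRankB helper `sum_consV` (decomp-qadv land package; see the module docstring). -/
theorem sum_consV {r : ℕ} {M : Type*} [AddCommMonoid M] (F : (Fin (r + 1) → ZMod p) → M) :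
    ∑ s, F s = ∑ σ : ZMod p, ∑ τ : Fin r → ZMod p, F (consV p σ τ) := by
  rw [← (Fin.consEquiv fun _ : Fin (r + 1) => ZMod p).sum_comp F, Fintype.sum_prod_type]
  rfl

/-- the combined direction of the class vector `(σ, τ)`. -/
theorem comb_consV {r : ℕ} (σ : ZMod p) (τ : Fin r → ZMod p) (A : Fin (r + 1) → Fin n → ZMod p) (i : Fin n) :
    comb p (consV p σ τ) A i = σ * A 0 i + ∑ j, τ j * A j.succ i := by
  unfold comb
  rw [Fin.sum_univ_succ]
  simp

/-- on the line of `A 0` the combined direction is `σ • A 0` and the phase is `σ s₀`. -/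
theorem comb_consV_zero {r : ℕ} (σ : ZMod p) (A : Fin (r + 1) → Fin n → ZMod p) (u : Fin n → Bool) :
    linF p (comb p (consV p σ 0) A) u = σ * linF p (A 0) u := by
  rw [linF_comb, Fin.sum_univ_succ]
  simp

/-- one-dimensional orthogonality: `p · #{WIN_y ∧ ⟨b,u⟩ = s₀} = Σ_σ ψ(−σ s₀) A_σ^{b}(y)`. -/
theorem class_count_eq_sum_form (c : ℕ) (b : Fin n → ZMod p) (y : Fin (n + 1) → (Fin n → Bool) → Bool) (s₀ : ZMod p) :
    (p : ℂ) * ((#{u : Fin n → Bool | ringWinU c y u = true ∧ linF p b u = s₀} : ℕ) : ℂ) =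
      ∑ σ : ZMod p, ZMod.stdAddChar (-(σ * s₀)) * formSum p b c y σ := by
  have e1 : ((#{u : Fin n → Bool | ringWinU c y u = true ∧ linF p b u = s₀} : ℕ) : ℂ) =
      ∑ u : Fin n → Bool, (if ringWinU c y u = true then (1 : ℂ) else 0) *
        (if linF p b u - s₀ = 0 then (1 : ℂ) else 0) := by
    rw [← sum_boole]
    refine sum_congr rfl fun u _ => ?_
    by_cases h1 : linF p b u = s₀ <;> by_cases h2 : ringWinU c y u = true <;> simp [h1, h2, sub_eq_zero]
  rw [e1, mul_sum]
  have e2 : ∀ u : Fin n → Bool, (p : ℂ) * ((if ringWinU c y u = true then (1 : ℂ) else 0) *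
      (if linF p b u - s₀ = 0 then (1 : ℂ) else 0)) =
      ∑ σ : ZMod p, ZMod.stdAddChar (-(σ * s₀)) *
        ((if ringWinU c y u = true then (1 : ℂ) else 0) * (ZMod.stdAddChar (σ * linF p b u) : ℂ)) := by
    intro u
    have h := ite_eq_sum_char p (linF p b u - s₀)
    rw [show (if linF p b u - s₀ = 0 then (p : ℂ) else 0) =
        (p : ℂ) * (if linF p b u - s₀ = 0 then 1 else 0) by rw [mul_ite, mul_one, mul_zero]] at h
    rw [mul_left_comm, h, mul_sum]
    refine sum_congr rfl fun σ _ => ?_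
    rw [show σ * (linF p b u - s₀) = σ * linF p b u + -(σ * s₀) by ring, AddChar.map_add_eq_mul]
    ring
  simp only [e2]
  rw [sum_comm]
  refine sum_congr rfl fun σ _ => ?_
  rw [formSum, mul_sum]

/-- **the class bound with the line of `A 0` separated**:
`p^{r+1} · #{vec u = s, WIN_y} ≤ p · #{⟨A₀,u⟩ = s₀, WIN_y} + Σ_σ Σ_{τ ≠ 0} ‖A₁^{σA₀ + Σ τ_j A_{j+1}}(y)‖`. -/
theorem class_count_le_formLine (c : ℕ) {r : ℕ} (A : Fin (r + 1) → Fin n → ZMod p)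
    (y : Fin (n + 1) → (Fin n → Bool) → Bool) (s : Fin (r + 1) → ZMod p) :
    (p : ℝ) ^ (r + 1) * #{u : Fin n → Bool | ringWinU c y u = true ∧ vecF p A u = s} ≤
      p * #{u : Fin n → Bool | ringWinU c y u = true ∧ linF p (A 0) u = s 0} +
        ∑ σ : ZMod p, ∑ τ ∈ univ.erase (0 : Fin r → ZMod p), ‖formSum p (comb p (consV p σ τ) A) c y 1‖ := by
  -- the full character expansion (as in `class_count_le_formR`)
  have hid : ((p : ℂ) ^ (r + 1)) * ((#{u : Fin n → Bool | ringWinU c y u = true ∧ vecF p A u = s} : ℕ) : ℂ) =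
      ∑ t : Fin (r + 1) → ZMod p, ZMod.stdAddChar (-(∑ j, t j * s j)) * formSum p (comb p t A) c y 1 := by
    have e1 : ((#{u : Fin n → Bool | ringWinU c y u = true ∧ vecF p A u = s} : ℕ) : ℂ) =
        ∑ u : Fin n → Bool, (if ringWinU c y u = true then (1 : ℂ) else 0) *
          (if vecF p A u - s = 0 then (1 : ℂ) else 0) := by
      rw [← sum_boole]
      refine sum_congr rfl fun u _ => ?_
      by_cases h1 : vecF p A u = s <;> by_cases h2 : ringWinU c y u = true <;> simp [h1, h2, sub_eq_zero]
    rw [e1, mul_sum]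
    have e2 : ∀ u : Fin n → Bool, ((p : ℂ) ^ (r + 1)) * ((if ringWinU c y u = true then (1 : ℂ) else 0) *
        (if vecF p A u - s = 0 then (1 : ℂ) else 0)) =
        ∑ t : Fin (r + 1) → ZMod p, ZMod.stdAddChar (-(∑ j, t j * s j)) *
          ((if ringWinU c y u = true then (1 : ℂ) else 0) * (ZMod.stdAddChar (1 * linF p (comb p t A) u) : ℂ)) := by
      intro u
      have h := ite_eq_sum_charR p (vecF p A u - s)
      rw [show (if vecF p A u - s = 0 then ((p : ℂ) ^ (r + 1)) else 0) =
          ((p : ℂ) ^ (r + 1)) * (if vecF p A u - s = 0 then 1 else 0) by rw [mul_ite, mul_one, mul_zero]] at h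
      rw [mul_left_comm, h, mul_sum]
      refine sum_congr rfl fun t _ => ?_
      have e3 : ∑ j, t j * (vecF p A u - s) j = 1 * linF p (comb p t A) u + -(∑ j, t j * s j) := by
        rw [one_mul, linF_comb, ← sub_eq_add_neg, ← sum_sub_distrib]
        refine sum_congr rfl fun j _ => ?_
        rw [Pi.sub_apply, mul_sub]; rfl
      rw [e3, AddChar.map_add_eq_mul]
      ring
    simp only [e2]
    rw [sum_comm]
    refine sum_congr rfl fun t _ => ?_
    rw [formSum, mul_sum]
  -- the line terms `τ = 0` sum to `p · #{⟨A₀,u⟩ = s₀, WIN}`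
  set F : (Fin (r + 1) → ZMod p) → ℂ := fun t => ZMod.stdAddChar (-(∑ j, t j * s j)) * formSum p (comb p t A) c y 1
    with hF
  have hline : ∀ σ : ZMod p, F (consV p σ 0) = ZMod.stdAddChar (-(σ * s 0)) * formSum p (A 0) c y σ := by
    intro σ
    simp only [hF, dot_consV_zero]
    congr 1
    unfold formSum
    refine sum_congr rfl fun u _ => ?_
    rw [one_mul, comb_consV_zero]
  have hsplit : ∑ t : Fin (r + 1) → ZMod p, F t =
      (p : ℂ) * ((#{u : Fin n → Bool | ringWinU c y u = true ∧ linF p (A 0) u = s 0} : ℕ) : ℂ) +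
        ∑ σ : ZMod p, ∑ τ ∈ univ.erase (0 : Fin r → ZMod p), F (consV p σ τ) := by
    rw [sum_consV p F, class_count_eq_sum_form p c (A 0) y (s 0), ← sum_add_distrib]
    refine sum_congr rfl fun σ _ => ?_
    rw [← add_sum_erase univ (fun τ => F (consV p σ τ)) (mem_univ (0 : Fin r → ZMod p)), hline]
  -- the difference is the dense sum; take norms
  have hdiff : (((p : ℝ) ^ (r + 1) * #{u : Fin n → Bool | ringWinU c y u = true ∧ vecF p A u = s} -
      p * #{u : Fin n → Bool | ringWinU c y u = true ∧ linF p (A 0) u = s 0} : ℝ) : ℂ) =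
      ∑ σ : ZMod p, ∑ τ ∈ univ.erase (0 : Fin r → ZMod p), F (consV p σ τ) := by
    push_cast
    rw [hid, hsplit]
    ring
  have hre : ((p : ℝ) ^ (r + 1) * #{u : Fin n → Bool | ringWinU c y u = true ∧ vecF p A u = s} -
      p * #{u : Fin n → Bool | ringWinU c y u = true ∧ linF p (A 0) u = s 0} : ℝ) ≤
      ∑ σ : ZMod p, ∑ τ ∈ univ.erase (0 : Fin r → ZMod p), ‖formSum p (comb p (consV p σ τ) A) c y 1‖ := by
    refine le_trans (Real.le_norm_self _) ?_
    rw [← Complex.norm_real, hdiff]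
    refine le_trans (norm_sum_le _ _) (sum_le_sum fun σ _ => le_trans (norm_sum_le _ _) (sum_le_sum fun τ _ => ?_))
    rw [hF]
    dsimp only
    rw [norm_mul, norm_char, one_mul]
  linarith

/-- **folding the line main terms into ONE-form dials**: summed over the classes `s = (σ, τ)`, the counts
`#{WIN_{Y_s} ∧ ⟨b,u⟩ = σ}` are the win counts of the one-form dials `σ ↦ Y_{(σ,τ)}` in direction `b`. -/
theorem sum_lineClass_eq (c : ℕ) {r : ℕ} (b : Fin n → ZMod p)
    (Y : (Fin (r + 1) → ZMod p) → Fin (n + 1) → (Fin n → Bool) → Bool) :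
    ∑ s : Fin (r + 1) → ZMod p, #{u : Fin n → Bool | ringWinU c (Y s) u = true ∧ linF p b u = s 0} =
      ∑ τ : Fin r → ZMod p, #{u : Fin n → Bool | ringWinU c (formStrat p b fun σ => Y (consV p σ τ)) u = true} := by
  rw [sum_consV p, sum_comm]
  refine sum_congr rfl fun τ _ => ?_
  rw [card_win_form_eq_sum]
  refine sum_congr rfl fun σ _ => ?_
  simp only [consV_zero]

/-- **ONE-SPARSE-LINE FOURIER REDUCTION**: if one-form dials of good strategies lose in EVERY direction (rate `θ₁`) and
good strategies have small form-twisted win sums in dense directions, then the `(r+1)`-form dial over `A₀, …, A_r` with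
every combination OFF the line of `A₀` dense loses (rate `(1+θ₁)/2`, any fixed `r`; `A₀` arbitrary). -/
theorem form_reductionLine (good : ∀ {n : ℕ}, ℕ → (Fin (n + 1) → (Fin n → Bool) → Bool) → Prop) {θ₁ : ℝ}
    (h1 : ∃ n₀ : ℕ, ∀ n ≥ n₀, ∀ (c : ℕ) (b : Fin n → ZMod p) (Y : ZMod p → Fin (n + 1) → (Fin n → Bool) → Bool),
      (∀ σ, good c (Y σ)) → (#{u : Fin n → Bool | ringWinU c (formStrat p b Y) u = true} : ℝ) ≤ θ₁ * 2 ^ n)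
    (h2 : ∀ ε : ℝ, 0 < ε → ∃ n₁ : ℕ, ∀ n ≥ n₁, ∀ (c : ℕ) (a : Fin n → ZMod p)
      (y : Fin (n + 1) → (Fin n → Bool) → Bool), good c y → n ≤ 2 * (univ.filter fun i : Fin n => a i ≠ 0).card →
        ∀ t : ZMod p, t ≠ 0 → ‖formSum p a c y t‖ ≤ ε * 2 ^ n) (hθ₁ : θ₁ < 1) (r : ℕ) :
    ∃ n₂ : ℕ, ∀ n ≥ n₂, ∀ (c : ℕ) (A : Fin (r + 1) → Fin n → ZMod p)
      (Y : (Fin (r + 1) → ZMod p) → Fin (n + 1) → (Fin n → Bool) → Bool),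
      (∀ (σ : ZMod p) (τ : Fin r → ZMod p), τ ≠ 0 →
        n ≤ 2 * (univ.filter fun i : Fin n => comb p (consV p σ τ) A i ≠ 0).card) →
        (∀ s, good c (Y s)) →
        (#{u : Fin n → Bool | ringWinU c (formStratR p A Y) u = true} : ℝ) ≤ (θ₁ + (1 - θ₁) / 2) * 2 ^ n := by
  obtain ⟨n₀, hn₀⟩ := h1
  have hp0 : (0 : ℝ) < p := by exact_mod_cast (Fact.out : p.Prime).pos
  have hpr : (0 : ℝ) < (p : ℝ) ^ (r + 1) := by positivity
  set ε : ℝ := (1 - θ₁) / 2 with hε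
  have hε0 : 0 < ε := by rw [hε]; linarith
  obtain ⟨n₁, hn₁⟩ := h2 (ε / p ^ (r + 1)) (by positivity)
  refine ⟨max n₀ n₁, fun n hn c A Y hdense hY => ?_⟩
  have hA : n₀ ≤ n := le_trans (le_max_left _ _) hn
  have hB : n₁ ≤ n := le_trans (le_max_right _ _) hn
  have h2n : (0 : ℝ) ≤ 2 ^ n := by positivity
  have hcardτ : ((univ.erase (0 : Fin r → ZMod p)).card : ℝ) ≤ (p : ℝ) ^ r := by
    have : (univ.erase (0 : Fin r → ZMod p)).card ≤ p ^ r :=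
      le_trans (card_erase_le) (by rw [card_univ, Fintype.card_fun, ZMod.card, Fintype.card_fin])
    exact_mod_cast this
  have hcardσ : ((univ : Finset (ZMod p)).card : ℝ) = p := by rw [card_univ, ZMod.card]
  -- per class: the dense terms are small
  have hcls : ∀ s : Fin (r + 1) → ZMod p,
      (p : ℝ) ^ (r + 1) * #{u : Fin n → Bool | ringWinU c (Y s) u = true ∧ vecF p A u = s} ≤
        p * #{u : Fin n → Bool | ringWinU c (Y s) u = true ∧ linF p (A 0) u = s 0} + ε * 2 ^ n := by
    intro s
    refine le_trans (class_count_le_formLine p c A (Y s) s) (add_le_add le_rfl ?_)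
    calc ∑ σ : ZMod p, ∑ τ ∈ univ.erase (0 : Fin r → ZMod p), ‖formSum p (comb p (consV p σ τ) A) c (Y s) 1‖
        ≤ ∑ σ : ZMod p, ∑ τ ∈ univ.erase (0 : Fin r → ZMod p), ε / p ^ (r + 1) * 2 ^ n :=
          sum_le_sum fun σ _ => sum_le_sum fun τ hτ =>
            hn₁ n hB c _ _ (hY s) (hdense σ τ (ne_of_mem_erase hτ)) 1 one_ne_zero
      _ ≤ ∑ σ : ZMod p, (p : ℝ) ^ r * (ε / p ^ (r + 1) * 2 ^ n) := sum_le_sum fun σ _ => by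
          rw [sum_const, nsmul_eq_mul]
          exact mul_le_mul_of_nonneg_right hcardτ (by positivity)
      _ = ε * 2 ^ n := by
          rw [sum_const, nsmul_eq_mul, hcardσ, pow_succ]
          field_simp
  -- the line main terms fold into one-form dials in direction `A 0`
  have hmain : (∑ s : Fin (r + 1) → ZMod p,
      (#{u : Fin n → Bool | ringWinU c (Y s) u = true ∧ linF p (A 0) u = s 0} : ℝ)) ≤ (p : ℝ) ^ r * (θ₁ * 2 ^ n) := by
    have e := sum_lineClass_eq p c (A 0) Y
    have e' : (∑ s : Fin (r + 1) → ZMod p,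
        (#{u : Fin n → Bool | ringWinU c (Y s) u = true ∧ linF p (A 0) u = s 0} : ℝ)) =
        ∑ τ : Fin r → ZMod p,
          (#{u : Fin n → Bool | ringWinU c (formStrat p (A 0) fun σ => Y (consV p σ τ)) u = true} : ℝ) := by
      exact_mod_cast e
    rw [e']
    calc _ ≤ ∑ τ : Fin r → ZMod p, θ₁ * 2 ^ n := sum_le_sum fun τ _ => hn₀ n hA c (A 0) _ fun σ => hY _
      _ = (p : ℝ) ^ r * (θ₁ * 2 ^ n) := by
          rw [sum_const, card_univ, Fintype.card_fun, ZMod.card, Fintype.card_fin, nsmul_eq_mul]; push_cast; ring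
  have hsum : (p : ℝ) ^ (r + 1) * #{u : Fin n → Bool | ringWinU c (formStratR p A Y) u = true} ≤
      (p : ℝ) ^ (r + 1) * (θ₁ * 2 ^ n + ε * 2 ^ n) := by
    rw [card_win_formR_eq_sum p c A Y]
    push_cast
    rw [mul_sum]
    calc _ ≤ ∑ s : Fin (r + 1) → ZMod p,
          ((p : ℝ) * #{u : Fin n → Bool | ringWinU c (Y s) u = true ∧ linF p (A 0) u = s 0} + ε * 2 ^ n) :=
          sum_le_sum fun s _ => hcls s
      _ = (p : ℝ) * ∑ s : Fin (r + 1) → ZMod p,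
            (#{u : Fin n → Bool | ringWinU c (Y s) u = true ∧ linF p (A 0) u = s 0} : ℝ) +
            (p : ℝ) ^ (r + 1) * (ε * 2 ^ n) := by
          rw [sum_add_distrib, mul_sum, sum_const, card_univ, Fintype.card_fun, ZMod.card, Fintype.card_fin,
            nsmul_eq_mul]; push_cast; ring
      _ ≤ (p : ℝ) * ((p : ℝ) ^ r * (θ₁ * 2 ^ n)) + (p : ℝ) ^ (r + 1) * (ε * 2 ^ n) := by
          nlinarith [hmain, hp0]
      _ = (p : ℝ) ^ (r + 1) * (θ₁ * 2 ^ n + ε * 2 ^ n) := by rw [pow_succ]; ring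
  have := le_of_mul_le_mul_left hsum hpr
  linarith

/-- **SPARSE directions, junta tables**: the one-form dial over `log₂ n`-junta tables loses whenever
`2·#{i : b_i ≠ 0} ≤ n` (slice on the support: on each subcube the strategy is a junta of the free bits, and
`walkHardAllSubcube` (δ₀ = 1/2) applies; no primality needed). -/
theorem form_sparse_junta_hard : ∃ θ₁ : ℝ, θ₁ < 1 ∧ ∃ n₀ : ℕ, ∀ n ≥ n₀, ∀ (c : ℕ) (b : Fin n → ZMod p)
    (Y : ZMod p → Fin (n + 1) → (Fin n → Bool) → Bool), (∀ s g, ∃ J : Finset (Fin n), J.card ≤ Nat.log 2 n ∧ ∀ u v : Fin n → Bool, (∀ i ∈ J, u i = v i) → Y s g u = Y s g v) →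
      2 * (univ.filter fun i : Fin n => b i ≠ 0).card ≤ n →
        (#{u : Fin n → Bool | ringWinU c (formStrat p b Y) u = true} : ℝ) ≤ θ₁ * 2 ^ n := by
  obtain ⟨θ, hθ, H⟩ := walkHardAllSubcube (δ₀ := 1 / 2) (by norm_num)
  refine ⟨θ, hθ, ?_⟩
  obtain ⟨n₀, hn₀⟩ := H 1
  refine ⟨n₀, fun n hn c a Y hY hsp => ?_⟩
  set W : Finset (Fin n) := univ.filter fun i : Fin n => a i ≠ 0 with hWdef
  have hW0 : ∀ i, i ∉ W → a i = 0 := fun i hi => by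
    by_contra h; exact hi (mem_filter.2 ⟨mem_univ _, h⟩)
  have hWcard : (W.card : ℝ) ≤ 1 / 2 * n := by
    have h' : ((2 * W.card : ℕ) : ℝ) ≤ n := by exact_mod_cast hsp
    push_cast at h'; linarith
  have hcube : ∀ b : Fin n → Bool,
      ((univ.filter fun u : Fin n → Bool => ringWinU c (formStrat p a Y) (subcubeMerge W b u) = true).card : ℝ) ≤
        θ * 2 ^ n := by
    intro b
    refine hn₀ n hn c W b hWcard (formStrat p a Y) fun g => ?_
    have e : (fun u => formStrat p a Y g (subcubeMerge W b u)) =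
        fun u => Y (linF p a (subcubeMerge W b fun _ => false)) g (subcubeMerge W b u) := by
      funext u; simp only [formStrat, linF_merge p hW0]
    rw [e]
    obtain ⟨J, hJ, hdep⟩ := hY (linF p a (subcubeMerge W b fun _ => false)) g
    exact BlockFibre37.hasDeg_of_dependsOn J (by rw [pow_one]; exact hJ) fun u v huv => hdep _ _ fun i hi => by
      by_cases hiW : i ∈ W
      · simp [subcubeMerge, hiW]
      · simp [subcubeMerge, hiW, huv i hi]
  have hsum := JLinPeel.sum_card_subcube W (fun v : Fin n → Bool => ringWinU c (formStrat p a Y) v = true)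
  have hsumR : ((2 ^ n * #{u : Fin n → Bool | ringWinU c (formStrat p a Y) u = true} : ℕ) : ℝ) =
      ∑ b : Fin n → Bool,
        ((univ.filter fun u : Fin n → Bool => ringWinU c (formStrat p a Y) (subcubeMerge W b u) = true).card : ℝ) := by
    rw [← hsum]; push_cast; rfl
  have hle : ∑ b : Fin n → Bool,
      ((univ.filter fun u : Fin n → Bool => ringWinU c (formStrat p a Y) (subcubeMerge W b u) = true).card : ℝ) ≤
        ∑ _b : Fin n → Bool, θ * 2 ^ n := sum_le_sum fun b _ => hcube b
  rw [sum_const, card_univ, Fintype.card_fun, Fintype.card_bool, Fintype.card_fin, nsmul_eq_mul, ← hsumR] at hle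
  push_cast at hle
  have h2n : (0 : ℝ) < 2 ^ n := by positivity
  nlinarith


end FormLine
end Summit.QuantumAdvantage.AdviceFreeQNC0.WindowCounter
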